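import Summits.BirchSwinnertonDyer.BirchSwinnertonDyer.Theses.CMKolyvaginAtInertTwo
import Summits.BirchSwinnertonDyer.BirchSwinnertonDyer.Theorems.CMKolyvaginAtInertTwoNonSquareConditionsAtTwo
import Summits.BirchSwinnertonDyer.BirchSwinnertonDyer.Theorems.GenusKolyvaginAtTwoGenusPrimitiveSupplyAtTwoHeegnerNonTorsionOfGZ
import Literature.NumberTheory.EllipticCurves.BSDSelmerPConverseRankOneRubinProofs
import Literature.NumberTheory.EllipticCurves.KolyvaginShaStructureIndexFormProofs
import Literature.NumberTheory.EllipticCurves.HeegnerPointsOfConductorOneData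
import Literature.NumberTheory.EllipticCurves.HeegnerPointsOfConductorOneRationalityProofs
import Literature.NumberTheory.EllipticCurves.HeegnerPointsProofs
import Literature.NumberTheory.EllipticCurves.BSDInvariantsProofs
import Literature.NumberTheory.EllipticCurves.GlobalMinimalModelProofs
import Literature.NumberTheory.EllipticCurves.QuadraticTwistJInvariantProofs
import Literature.NumberTheory.EllipticCurves.ComplexMultiplicationHasCMProofs
import Summits.BirchSwinnertonDyer.Rank1Residual.O5.HeegnerLogTransportThreeTraceCert
import HarnessLib

/-!
# Route `CMKolyvaginAtInertTwo`, crux #2 `CMPrimitiveSupplyAtInertTwo` (stmt-BirchSwinnertonDyer-24276):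
# THE SUPPLY CRUX IS «KOLYVAGIN'S CONJECTURE AT p = 2 ON H₂» PLUS PRINT — the print part proved

Seat `bsd-line-cmk2-p1` g3 (cell `bsd-print-cf2`); helper (`--supports stmt-BirchSwinnertonDyer-24276`).
THEOREMS ONLY: no definition, no named fact, no `sorry`; no item is closed; BSD is not proved by this.

WHAT. The supply crux (X-P supply on the habitat H₂: `HasCM`, `CMInert W 2`, `ρ̄_{E,2}` onto,
`r_an = 1`, odd Tamagawa, an optimal parametrisation with odd Manin constant) asks for SEVEN things:
(1) a Heegner field `K` (imaginary quadratic, odd `d_K ≠ −3`, every `q ∣ N_E` split);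
(2) Kolyvagin's two non-square exclusions `d_K·(−|Δ|), d_K·(−2|Δ|) ∉ ℚ²`; (3) a frame
`(Dt, β, ι, d₁)` with `Dt` optimal of odd Manin constant; (4) `y_K = P(1)` of infinite order;
(5) its exact `2`-divisibility exponent `M₀` in `E(K[1])`; (6) a square-free product `n` of
Kolyvagin primes at `2` inert in `F` with `P(n) ∉ 2E(K[n])` (a `2`-PRIMITIVE derived class);
(7) a globally minimal twin `Wd ≅ E^{(d_K)}` with CM and `r_an(Wd) = 0`.
Of these, (6) is Kolyvagin's conjecture at `p = 2` in the CM-inert case (Gross 1991 Question 11;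
printed for `p` odd / `p ≥ 5` only: Kolyvagin 1991, W. Zhang 2014) — the crux's genuine content.
EVERYTHING ELSE IS PRINT or bookkeeping, and this file proves it:

* (1)+(4) `exists_heegnerField_derivedPoint_one_not_isOfFinAddOrder` — from Hoffstein–Luo
  (`HoffsteinLuo1997_exists_twist_L_one_ne_zero`: an odd fundamental `d ≡ 1 (mod 8)` with every
  `q ∣ 3N_E` split and `L(E^{(d)}, 1) ≠ 0`, tree `exists_heegnerField_odd_split_twist_ne_zero_of_hoffsteinLuo`),
  modularity (`exists_isNewformOf`: `w(E) = −1` from `r_an = 1`; entire `L`-functions) and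
  Gross–Zagier (`gross_zagier N_E W K`: `ord L(E/K) = 1 + 0 = 1`, so `L'(E/K,1) ≠ 0`, so the Heegner
  point under `P(1)` has infinite order — the mirror image of gk2-p4's
  `GenusKoly.not_isOfFinAddOrder_derivedPoint_one_of_grossZagier`); `3` split in `K` gives `d_K ≠ −3`;
* (2) is AUTOMATIC on H₂ (`KolyvaginFrobeniusTwo.not_isSquare_and_of_cmInert_two_of_heegner`, p594125);
* (3) `β` from the Heegner condition (`exists_dvd_sq_sub_discr_holds`), `d₁` from Darmon's Thm. 3.6
  (`exists_kolyvaginHeegnerData_one` with `phi_heegnerTau_mem_singularModuliField_holds`), `Dt` = the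
  habitat's own datum;
* (5) Mordell–Weil over the number field `K[1]` (`exists_pow_smul_eq_and_not_of_not_isOfFinAddOrder`);
* (7) `hasGlobalMinimalModel_rat_holds`, `HasCM` depends on `j` only (`hasCM_iff_of_j_eq`,
  `j_quadraticTwist`), `r_an` is model-invariant (`analyticRank_smul`) and `r_an(E^{(d_K)}) = 0` IS
  `L(E^{(d_K)}, 1) ≠ 0` (`analyticRank_eq_zero_iff_holds`).

NET: `cmPrimitiveSupplyAtInertTwo_of_kolyvaginConjectureAtTwo :
exists_isNewformOf → HoffsteinLuo1997 → (∀ N W K, gross_zagier N W K) → (KOLY₂) → CMPrimitiveSupplyAtInertTwo`,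
where (KOLY₂) — spelled out in binders, no definition — is «for every member of H₂, every admissible
Heegner field `K` (odd `d_K ≠ −3`, Heegner hypothesis) and every frame `(Dt optimal odd-Manin, β, ι,
d₁)` with `y_K` of infinite order, SOME square-free product `n` of Zhang-Kolyvagin primes at `2`
inert in `F` has `P(n) ∉ 2E(K[n])`» = Kolyvagin's conjecture at `2` (CM, `2` inert), the statement
the line's (HU) child «2-adic units `L(ψ_E χ, 1)`, Cai–Shu–Tian» is meant to prove. TURNKEY for the
pen (the 22837 → 24154 pattern): re-type crux #2 as (KOLY₂) and file the twin
`CMPrimitiveSupplyAtInertTwoOfFacts := (exists_isNewformOf ∧ HoffsteinLuo1997 ∧ GZ∀) → (KOLY₂) →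
CMPrimitiveSupplyAtInertTwo`, closer = this theorem. BSD is not proved by any of this.

References: [GrossLMS1991] §1 (1.1), §3, §11 Question; [GrossZagier1986] Thm. I.6.3, V.§2, I.§7;
[HoffsteinLuo1997] Theorem; [Kolyvagin1991StructureSha]; [WZhang2014] Thm. 1.1 (p ≥ 5);
[McCallumLMS1991] §5 Lemma 5.1; [SilvermanAEC2009] VIII.8.3, X.5.4, C.16; [Darmon2004] Thm. 3.6.
-/

-- single-conjunct summit: `Summit.BirchSwinnertonDyer.BirchSwinnertonDyer.…` repeats the name by design
set_option linter.dupNamespace false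
set_option autoImplicit false

noncomputable section

open scoped Classical

namespace Summit.BirchSwinnertonDyer.BirchSwinnertonDyer.Theorems.CMSupply

open WeierstrassCurve NumberField
open Literature.NumberTheory.EllipticCurves Literature.NumberTheory.EllipticCurves.ModularForms
open Literature.NumberTheory.EllipticCurves.Rank1Residual
open Summit.BirchSwinnertonDyer.BirchSwinnertonDyer.Theses.CMKolyvaginAtInertTwo (CMPrimitiveSupplyAtInertTwo)

/-! ## §1 `y_K` of infinite order for the rank-one member, modulo Gross–Zagier and modularity -/

/-- **`ord_{s=1} L(E/K,s) = 1` when `r_an(E) = 1` and `L(E^{(d_K)},1) ≠ 0`**, both `L`-functions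
entire (modularity `exists_isNewformOf`): `1 + 0 = 1` (gk2-p4's per-pair additivity
`GenusKoly.analyticRankEK_eq_add_of_hasEntireLFunction`, Gross–Zagier I.§7).
[cite: GrossZagier1986, I.§7] [cite: BCDTJAMS2001, Theorem A] -/
theorem analyticRankEK_eq_one_of_rankOne (hmod : exists_isNewformOf) (W : WeierstrassCurve ℚ)
    [W.IsElliptic] (K : Type) [Field K] [NumberField K] (hr1 : W.analyticRank = 1)
    (hL : (W.quadraticTwist (NumberField.discr K : ℚ)).entireLFunction 1 ≠ 0) :
    analyticRankEK W K = 1 := by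
  have hE : hasEntireLFunction_rat := hasEntireLFunction_rat_of_exists_isNewformOf hmod
  have hd : (NumberField.discr K : ℚ) ≠ 0 := by exact_mod_cast NumberField.discr_ne_zero K
  haveI := W.isElliptic_quadraticTwist hd
  have h0 : (W.quadraticTwist (NumberField.discr K : ℚ)).analyticRank = 0 :=
    ((W.quadraticTwist (NumberField.discr K : ℚ)).analyticRank_eq_zero_iff_holds (hE _)).mpr hL
  rw [GenusKoly.analyticRankEK_eq_add_of_hasEntireLFunction W K (hE W) (hE _), hr1, h0]

/-- **`y_K = P(1)` has infinite order when `r_an(E) = 1` and `L(E^{(d_K)},1) ≠ 0`, modulo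
Gross–Zagier and modularity** (the rank-one mirror of gk2-p4's
`GenusKoly.not_isOfFinAddOrder_derivedPoint_one_of_grossZagier`): `ord L(E/K) = 1`, so
`L'(E/K,1) ≠ 0`; the Heegner point `P₀ ∈ E(K)` under `P(1)` (Gross 1991 §4, PROVED descent at
conductor `1` with Shimura reciprocity) has infinite order by Gross–Zagier, and `E(K) → E(K[1])`
is injective. [cite: GrossZagier1986, Thm. I.6.3 with V.§2 and I.§7]
[cite: GrossLMS1991, §1 (1.1) and §4 (P_1 = y_K)] -/
theorem not_isOfFinAddOrder_derivedPoint_one_of_rankOne (hmod : exists_isNewformOf)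
    (W : WeierstrassCurve ℚ) [W.IsElliptic] [NeZero (W.conductorNorm ℤ)]
    (K : Type) [Field K] [NumberField K] (hGZ : gross_zagier (W.conductorNorm ℤ) W K)
    (hK : IsImaginaryQuadratic K) (hH : SatisfiesHeegnerHypothesis (W.conductorNorm ℤ) K)
    (hr1 : W.analyticRank = 1) (hL : (W.quadraticTwist (NumberField.discr K : ℚ)).entireLFunction 1 ≠ 0)
    {Dt : ModularParametrizationData W (W.conductorNorm ℤ)} {β : ℤ} {ι : K →+* ℂ}
    (d₁ : KolyvaginHeegnerData Dt β ι 1) : ¬ IsOfFinAddOrder d₁.derivedPoint := by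
  have hEK : analyticRankEK W K = 1 := analyticRankEK_eq_one_of_rankOne hmod W K hr1 hL
  have hLd : LDerivEK W K ≠ 0 := LDerivEK_ne_zero_of_analyticRankEK_eq_one W K hEK
  obtain ⟨P₀, hP₀, hmap⟩ := heegnerSystem_exists_isHeegnerPoint_map_eq_derivedPoint_one
    (heegnerPointOfConductor_one_galoisConj_holds (W.conductorNorm ℤ) W K) hK hH d₁
  have hP₀inf : ¬ IsOfFinAddOrder P₀ :=
    (lDerivEK_ne_zero_iff_not_isOfFinAddOrder W (W.conductorNorm ℤ) K hGZ hK hH hP₀).mp hLd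
  intro hfin
  apply hP₀inf
  rw [← hmap] at hfin
  exact (WeierstrassCurve.Affine.Point.map_injective (W' := W) _).isOfFinAddOrder_iff.mp hfin

/-- **(1)+(4): a Kolyvagin-admissible Heegner field with `y_K` of infinite order, for every
`E/ℚ` of analytic rank one** (Hoffstein–Luo + modularity + Gross–Zagier): an imaginary quadratic
`K` with ODD `d_K ≠ −3` (indeed `3` splits in `K`), every `q ∣ N_E` split, `L(E^{(d_K)}, 1) ≠ 0`,
and — for every frame `(Dt, β, ι, d₁)` at level `N_E` — `P(1)` of infinite order.
[cite: HoffsteinLuo1997, Theorem (§1)] [cite: GrossZagier1986, Thm. I.6.3 with V.§2]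
[cite: BCDTJAMS2001, Theorem A] -/
theorem exists_heegnerField_derivedPoint_one_not_isOfFinAddOrder (hmod : exists_isNewformOf)
    (hHL : HoffsteinLuo1997_exists_twist_L_one_ne_zero)
    (hGZ : ∀ (N : ℕ) [NeZero N] (W : WeierstrassCurve ℚ) (K : Type) [Field K] [NumberField K],
      gross_zagier N W K)
    (W : WeierstrassCurve ℚ) [W.IsElliptic] [NeZero (W.conductorNorm ℤ)] (hr1 : W.analyticRank = 1) :
    ∃ (K : Type) (_ : Field K) (_ : NumberField K), IsImaginaryQuadratic K ∧
      Odd (NumberField.discr K) ∧ NumberField.discr K ≠ -3 ∧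
      SatisfiesHeegnerHypothesis (W.conductorNorm ℤ) K ∧
      (W.quadraticTwist (NumberField.discr K : ℚ)).entireLFunction 1 ≠ 0 ∧
      ∀ (Dt : ModularParametrizationData W (W.conductorNorm ℤ)) (β : ℤ) (ι : K →+* ℂ)
        (d₁ : KolyvaginHeegnerData Dt β ι 1), ¬ IsOfFinAddOrder d₁.derivedPoint := by
  have hw : W.rootNumber = -1 :=
    Summit.BirchSwinnertonDyer.Rank1Residual.O5.HeegnerLogTransport.rootNumber_eq_neg_one_of_analyticRank_eq_one
      hmod W hr1
  haveI : Fact (Nat.Prime 3) := ⟨Nat.prime_three⟩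
  obtain ⟨K, _, _, hK, hodd, hH, h3, hL⟩ :=
    exists_heegnerField_odd_split_twist_ne_zero_of_hoffsteinLuo hmod hHL W hw 3
  refine ⟨K, _, _, hK, hodd, ?_, hH, hL, fun Dt β ι d₁ ↦
    not_isOfFinAddOrder_derivedPoint_one_of_rankOne hmod W K (hGZ _ W K) hK hH hr1 hL d₁⟩
  -- `3` splits in `K`, so `3 ∤ d_K`, so `d_K ≠ -3`
  have hH3 : SatisfiesHeegnerHypothesis 3 K := by
    intro p hp hp3
    have : p = 3 := (Nat.prime_dvd_prime_iff_eq hp Nat.prime_three).mp hp3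
    subst this
    exact_mod_cast h3
  have h3d : ¬ ((3 : ℕ) : ℤ) ∣ NumberField.discr K :=
    not_dvd_discr_of_satisfiesHeegnerHypothesis hK hH3 Nat.prime_three (dvd_refl 3)
  intro h
  apply h3d
  rw [h]
  norm_num

/-! ## §2 The twin (7) -/

/-- **(7): a globally minimal twin `Wd ≅ E^{(d_K)}` with CM and `r_an(Wd) = 0`**, for `E` with CM
and `L(E^{(d_K)}, 1) ≠ 0` (global minimal models over `ℚ`, `HasCM` depends on `j` only, `r_an` is
model-invariant and vanishes iff `L(·,1) ≠ 0` for an entire `L`-function).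
[cite: SilvermanAEC2009, VIII.8 Cor. 8.3, X.5 Cor. 5.4, C.16] [cite: BCDTJAMS2001, Theorem A] -/
theorem exists_minimal_twin_hasCM_analyticRank_zero (hmod : exists_isNewformOf)
    (W : WeierstrassCurve ℚ) [W.IsElliptic] (hCM : W.HasCM) (K : Type) [Field K] [NumberField K]
    (hL : (W.quadraticTwist (NumberField.discr K : ℚ)).entireLFunction 1 ≠ 0) :
    ∃ (Wd : WeierstrassCurve ℚ) (_ : Wd.IsElliptic) (_ : Wd.IsGloballyMinimal),
      (∃ C : WeierstrassCurve.VariableChange ℚ, C • W.quadraticTwist (NumberField.discr K : ℚ) = Wd) ∧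
      Wd.HasCM ∧ Wd.analyticRank = 0 := by
  have hE : hasEntireLFunction_rat := hasEntireLFunction_rat_of_exists_isNewformOf hmod
  have hd : (NumberField.discr K : ℚ) ≠ 0 := by exact_mod_cast NumberField.discr_ne_zero K
  haveI := W.isElliptic_quadraticTwist hd
  obtain ⟨C, hC⟩ := hasGlobalMinimalModel_rat_holds (W.quadraticTwist (NumberField.discr K : ℚ))
  refine ⟨C • W.quadraticTwist (NumberField.discr K : ℚ), inferInstance, hC, ⟨C, rfl⟩, ?_, ?_⟩
  · have hj : (C • W.quadraticTwist (NumberField.discr K : ℚ)).j = W.j := by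
      rw [WeierstrassCurve.variableChange_j, W.j_quadraticTwist hd]
    exact (hasCM_iff_of_j_eq hj).mpr hCM
  · rw [analyticRank_smul (W.quadraticTwist (NumberField.discr K : ℚ)) C]
    exact ((W.quadraticTwist (NumberField.discr K : ℚ)).analyticRank_eq_zero_iff_holds (hE _)).mpr hL

/-! ## §3 The reduction: supply = print + Kolyvagin's conjecture at `2` on H₂ -/

/-- **CRUX #2 `CMPrimitiveSupplyAtInertTwo` FROM KOLYVAGIN'S CONJECTURE AT `p = 2` ON H₂ AND PRINT.**
Hypotheses: modularity `exists_isNewformOf` (BCDT 2001), Hoffstein–Luo's non-vanishing twist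
(`HoffsteinLuo1997_exists_twist_L_one_ne_zero`), the Gross–Zagier formula at every level
(`gross_zagier`), and (KOLY₂) — Kolyvagin's conjecture at `2` in the CM-inert case, spelled out in
the crux's own binders: for every member of H₂ (CM, `2` inert in `F`, `ρ̄_{E,2}` onto, `r_an = 1`,
odd Tamagawa), every imaginary quadratic `K` with odd `d_K ≠ −3` and the Heegner hypothesis,
every optimal odd-Manin datum `Dt`, `β`, `ι`, `d₁` with `y_K = P(1)` of infinite order, there are
a square-free `n` whose prime factors are Zhang-Kolyvagin primes at `2` inert in `F` and a
level-`n` datum `d` with `P(n) ∉ 2E(K[n])`. Conclusion: the crux, VERBATIM. Proof: §1 supplies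
`K` and `y_K` of infinite order, p594125 the two non-square exclusions, Darmon 3.6 the frame,
Mordell–Weil over `K[1]` the exponent `M₀`, (KOLY₂) the primitive class, §2 the twin.
[cite: GrossLMS1991, §11 (Question) and §3] [cite: Kolyvagin1991StructureSha, Conjecture]
[cite: WZhang2014, Thm. 1.1] [cite: HoffsteinLuo1997, Theorem] [cite: GrossZagier1986, Thm. I.6.3] -/
theorem cmPrimitiveSupplyAtInertTwo_of_kolyvaginConjectureAtTwo (hmod : exists_isNewformOf)
    (hHL : HoffsteinLuo1997_exists_twist_L_one_ne_zero)
    (hGZ : ∀ (N : ℕ) [NeZero N] (W : WeierstrassCurve ℚ) (K : Type) [Field K] [NumberField K],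
      gross_zagier N W K)
    (hKoly : ∀ (W : WeierstrassCurve ℚ) [W.IsElliptic] [W.IsGloballyMinimal] [NeZero (W.conductorNorm ℤ)],
      W.HasCM → CMInert W 2 → W.HasSurjectiveModNGaloisRep (2 : ℤ) → W.analyticRank = 1 →
      Odd W.tamagawaProduct →
      ∀ (K : Type) [Field K] [NumberField K], IsImaginaryQuadratic K → Odd (NumberField.discr K) →
      NumberField.discr K ≠ -3 → SatisfiesHeegnerHypothesis (W.conductorNorm ℤ) K →
      ∀ (Dt : ModularParametrizationData W (W.conductorNorm ℤ)),
      (∀ z ∈ Dt.L.lattice, ∃ w ∈ periodLattice Dt.f, z = (Dt.c : ℂ) * w) → Odd Dt.c →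
      ∀ (β : ℤ) (ι : K →+* ℂ) (d₁ : KolyvaginHeegnerData Dt β ι 1), ¬ IsOfFinAddOrder d₁.derivedPoint →
      ∃ (n : ℕ) (d : KolyvaginHeegnerData Dt β ι n), Squarefree n ∧
        (∀ ℓ ∈ n.primeFactors, (Zhang2014.IsKolyvaginPrime (W.conductorNorm ℤ) W K 2 ℓ ∧ CMInert W ℓ)) ∧
        ¬ ∃ Q : (W.baseChange (ringClassField K ι n)).toAffine.Point, (2 : ℤ) • Q = d.derivedPoint) :
    CMPrimitiveSupplyAtInertTwo := by
  intro W _ _ _ hCM hin hρ hr hT hopt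
  obtain ⟨Dt, hDt, hc⟩ := hopt
  -- (1)+(4): the Heegner field and `y_K` of infinite order
  obtain ⟨K, _, _, hK, hodd, h3, hH, hL, hy⟩ :=
    exists_heegnerField_derivedPoint_one_not_isOfFinAddOrder hmod hHL hGZ W hr
  -- (2): the two non-square exclusions are automatic on H₂
  obtain ⟨hsq1, hsq2⟩ :=
    KolyvaginFrobeniusTwo.not_isSquare_and_of_cmInert_two_of_heegner W hCM hin hρ K hK hodd hH
  -- (3): the frame `(Dt, β, ι, d₁)`
  obtain ⟨β, hβ⟩ := exists_dvd_sq_sub_discr_holds (W.conductorNorm ℤ) K hK hH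
  let ι : K →+* ℂ := Classical.choice inferInstance
  obtain ⟨d₁⟩ := exists_kolyvaginHeegnerData_one
    (phi_heegnerTau_mem_singularModuliField_holds (W.conductorNorm ℤ) W K) hK Dt β ι hβ
  have hy₁ : ¬ IsOfFinAddOrder d₁.derivedPoint := hy Dt β ι d₁
  -- (5): the exact exponent `M₀` (Mordell–Weil over the number field `K[1]`)
  haveI : NumberField (ringClassField K ι 1) := numberField_ringClassField hK ι one_ne_zero
  haveI : (W.baseChange (ringClassField K ι 1)).IsElliptic := by rw [baseChange]; infer_instance
  haveI : Module.Finite ℤ (W.baseChange (ringClassField K ι 1)).toAffine.Point := by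
    convert (W.baseChange (ringClassField K ι 1)).module_finite_point_holds
  obtain ⟨M₀, hdiv, hndiv⟩ := exists_pow_smul_eq_and_not_of_not_isOfFinAddOrder Nat.prime_two hy₁
  -- (6): Kolyvagin's conjecture at `2`
  obtain ⟨n, d, hn, hKol, hprim⟩ := hKoly W hCM hin hρ hr hT K hK hodd h3 hH Dt hDt hc β ι d₁ hy₁
  -- (7): the twin
  obtain ⟨Wd, _, _, hWd, hcmd, hrd⟩ := exists_minimal_twin_hasCM_analyticRank_zero hmod W hCM K hL
  exact ⟨K, _, _, hK, hodd, h3, hH, hsq1, hsq2, Dt, β, ι, d₁, hDt, hc, hy₁, M₀, hdiv, hndiv,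
    n, d, hn, hKol, hprim, Wd, ‹_›, ‹_›, hWd, hcmd, hrd⟩

/-! ## Append 1 (same seat): the bundle shape of the twin `CMPrimitiveSupplyAtInertTwoOfFacts` -/

/-- **The four-antecedent closer in BUNDLE shape** — the exact body of the twin
`CMPrimitiveSupplyAtInertTwoOfFacts` proposed in `Cruxes/CMExactDescentAtTwo/TURNKEY_route_edit_24276.lean`:
`(exists_isNewformOf ∧ HoffsteinLuo1997_exists_twist_L_one_ne_zero ∧ (∀ N W K, gross_zagier N W K)) →
KOLY₂ → CMPrimitiveSupplyAtInertTwo`, so that the gate can match the twin BY TYPE at render (as it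
did for 24154 with `CMExactDescent.cmExactDescentAtTwo_ofFacts`). [cite: GrossLMS1991, §11 (Question) and §3]
[cite: HoffsteinLuo1997, Theorem] [cite: GrossZagier1986, Thm. I.6.3] -/
theorem cmPrimitiveSupplyAtInertTwo_ofFacts :
    (exists_isNewformOf ∧ HoffsteinLuo1997_exists_twist_L_one_ne_zero ∧
      (∀ (N : ℕ) [NeZero N] (W : WeierstrassCurve ℚ) (K : Type) [Field K] [NumberField K],
        gross_zagier N W K)) →
    (∀ (W : WeierstrassCurve ℚ) [W.IsElliptic] [W.IsGloballyMinimal] [NeZero (W.conductorNorm ℤ)],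
      W.HasCM → CMInert W 2 → W.HasSurjectiveModNGaloisRep (2 : ℤ) → W.analyticRank = 1 →
      Odd W.tamagawaProduct →
      ∀ (K : Type) [Field K] [NumberField K], IsImaginaryQuadratic K → Odd (NumberField.discr K) →
      NumberField.discr K ≠ -3 → SatisfiesHeegnerHypothesis (W.conductorNorm ℤ) K →
      ∀ (Dt : ModularParametrizationData W (W.conductorNorm ℤ)),
      (∀ z ∈ Dt.L.lattice, ∃ w ∈ periodLattice Dt.f, z = (Dt.c : ℂ) * w) → Odd Dt.c →
      ∀ (β : ℤ) (ι : K →+* ℂ) (d₁ : KolyvaginHeegnerData Dt β ι 1), ¬ IsOfFinAddOrder d₁.derivedPoint →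
      ∃ (n : ℕ) (d : KolyvaginHeegnerData Dt β ι n), Squarefree n ∧
        (∀ ℓ ∈ n.primeFactors, (Zhang2014.IsKolyvaginPrime (W.conductorNorm ℤ) W K 2 ℓ ∧ CMInert W ℓ)) ∧
        ¬ ∃ Q : (W.baseChange (ringClassField K ι n)).toAffine.Point, (2 : ℤ) • Q = d.derivedPoint) →
    CMPrimitiveSupplyAtInertTwo :=
  fun h hKoly ↦ cmPrimitiveSupplyAtInertTwo_of_kolyvaginConjectureAtTwo h.1 h.2.1 h.2.2 hKoly

end Summit.BirchSwinnertonDyer.BirchSwinnertonDyer.Theorems.CMSupply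

end
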